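/-
Origin: expansion seat `planner-pub-hodgecm-toy2-g5-0`, handover #6 2026-08-18T09:05:02Z (`HOME/pub-hodgecm-toy2-g5/lean/Toy2g5/PohlmannNoN4.lean`, md5 bb695886, 193 lines);
landed by the gen-7 packager in gate run 27 as `HodgeCM/Proofs/Pohlmann/PohlmannNoN4.lean` (stripped 1 #print/#check/#eval lines).
-/
/-
Copyright: pub-hodgecm formalisation cell (harness21, 2026). New file (not vendored).
Origin: HOME/pub-hodgecm-toy2-g5/lean/Toy2g5/PohlmannNoN4.lean — session planner-pub-hodgecm-toy2-g5-0 (unit pub-hodgecm-toy2-g5,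
CONSISTENCY seat 2, part (6a)(ii), generation 5).  WIP module `Toy2g5.PohlmannNoN4`; intended final place
`HodgeCM/Proofs/Pohlmann/PohlmannNoN4.lean` (module `HodgeCM.Proofs.Pohlmann.PohlmannNoN4`).  All imports are final tree names.
-/
import Summits.HodgeConjecture.HodgeCM.Proofs.Pohlmann.WeightHodge

/-!
# Pohlmann's span theorem without N4: `PohlmannSpan` from `ModelAxioms` + N1 + N2 + N3

`HodgeCM.Universe.pohlmannSpan_of_facts` (Proofs/Pohlmann/WeightHodge.lean) derives `U.PohlmannSpan` from the model axioms
and the four textbook facts N1 `Fact_cupExterior`, N2 `Fact_cup_hodge`, N3 `Fact_pull_H0`, N4 `Fact_hodge_F0`, through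
M29 `Fact_weightSpan` (`weightSpan_of_facts M hN1 hN3`) and M30 `Fact_weightHodge` (`weightHodge_of_facts M hN1 hN2 hN3 hN4`).
N4 (`F⁰H^k = H^k`) enters only through the DEGREE-ZERO case of M30 (`weightSpace_le_piece_zero M hN3 hN4`), while the span
theorem at level `p` consumes M30 only in degree `2p` (`types_of_meets`), and at level `p = 0` needs no Hodge theory at all:
under N3 every class of `H⁰(A′, ℂ)` is a weight vector of the EMPTY weight, which is a Hodge weight for `p = 0`.

This file makes that bookkeeping formal:

* `Fact_weightHodgeAt U k` — M30 in one degree `k`; `weightHodgeAt_succ_of_facts (M) (hN1) (hN2) (k)` — it holds in every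
  positive degree from M1–M28 + N1 + N2 alone (= `weightSpace_le_piece_succ`);
* `types_of_meetsAt`, `isHodgeWeight_of_meetsAt`, `pohlmannSpanAt_of_weightHodgeAt (M) (h29) (p) (h30 : U.Fact_weightHodgeAt (2*p))`
  — the level-`p` span inclusion from M29 and M30 IN DEGREE `2p` ONLY (the proofs are those of `HodgeCM.Proofs.PohlmannSpan`,
  verbatim but for the localised hypothesis);
* `pohlmannSpanAt_zero_of_pull_H0 (hN3)` — the level-`0` inclusion from N3 alone (both conclusions are, verbatim, the
  clause `U.PohlmannSpanAt F n Θ p` of `HodgeCM.Model.Toy.ToyPadH6At`, not imported here to keep `Proofs` free of `Model`);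
* **`pohlmannSpan_of_facts₃ (M) (hN1) (hN2) (hN3) : U.PohlmannSpan`** — Pohlmann's span theorem WITHOUT N4.

Together with the separating models of `HodgeCM.Model.Toy.ToyPadH6` (N1), `HodgeCM.Model.Toy.ToyPadH0Two` (N3) this leaves N2 as
the only input of the span theorem whose necessity is undecided in the package; N4 remains load-bearing for M30 itself
(`HodgeCM.Model.Toy.ToyPadH0J`: a model of M1–M28 + N1 + N2 + N3 + `PohlmannSpan` + `HC_CM` violating N4 and M30).
Nothing is cited; Lean + Mathlib axioms only.
-/

noncomputable section

open scoped TensorProduct NumberField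
open Polynomial

namespace HodgeCM

open Literature.AlgebraicGeometry.Motives (CMType HodgeStructure)
open Literature.AlgebraicGeometry.Motives.HodgeStructure (ofRat ofRat_apply)
open HodgeCM.Pohlmann

namespace Universe

variable {U : Universe}

/-! ### M30 degree by degree -/

/-- **M30 in one degree `k`**: weight vectors of weight `S` in `H^k(A′, ℂ)` have Hodge type `(p_S, q_S)`. -/
def Fact_weightHodgeAt (U : Universe) (k : ℕ) : Prop :=
  ∀ (F : CMField) (n : ℕ) (Θ : Fin (n + 1) → CMType F) (S : Fin (n + 1) → Finset ((F : Type) →+* ℂ)),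
    U.weightSpace F Θ S k ≤
      (U.hodge (U.cmProd F Θ) k).piece (∑ j, ∑ s ∈ S j, ind (Θ j) s) (∑ j, ∑ s ∈ S j, (1 - ind (Θ j) s))

/-- (Ported verbatim from the HodgeCMPerL package; no docstring in the source.) -/
theorem weightHodge_iff_forall_weightHodgeAt : U.Fact_weightHodge ↔ ∀ k, U.Fact_weightHodgeAt k :=
  ⟨fun h k F n Θ S => h F n Θ k S, fun h F n Θ k S => h k F n Θ S⟩

/-- **M30 in every positive degree is a theorem of `ModelAxioms` + N1 + N2** (no N3, no N4): `weightSpace_le_piece_succ`. -/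
theorem weightHodgeAt_succ_of_facts (M : U.ModelAxioms) (hN1 : U.Fact_cupExterior) (hN2 : U.Fact_cup_hodge) (k : ℕ) :
    U.Fact_weightHodgeAt (k + 1) :=
  fun _ _ _ S => weightSpace_le_piece_succ M hN1 hN2 k S

/-- (Ported verbatim from the HodgeCMPerL package; no docstring in the source.) -/
theorem weightHodgeAt_of_facts_of_pos (M : U.ModelAxioms) (hN1 : U.Fact_cupExterior) (hN2 : U.Fact_cup_hodge) {k : ℕ}
    (hk : 0 < k) : U.Fact_weightHodgeAt k := by
  obtain ⟨k, rfl⟩ := Nat.exists_eq_succ_of_ne_zero hk.ne'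
  exact weightHodgeAt_succ_of_facts M hN1 hN2 k

/-- M30 in degree `0` is where N3 and N4 are used (`weightSpace_le_piece_zero`). -/
theorem weightHodgeAt_zero_of_facts (M : U.ModelAxioms) (hN3 : U.Fact_pull_H0) (hN4 : U.Fact_hodge_F0) :
    U.Fact_weightHodgeAt 0 :=
  fun _ _ _ S => weightSpace_le_piece_zero M hN3 hN4 S

/-! ### The span theorem at level `p` from M30 in degree `2p` only -/

section Weights

variable {F : CMField} {n : ℕ} {Θ : Fin (n + 1) → CMType F}

/-- A weight met by the Hodge classes has `p_S = q_S = p` — using M30 in degree `2p` only (cf. `types_of_meets`). -/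
theorem types_of_meetsAt (p : ℕ) (h30 : U.Fact_weightHodgeAt (2 * p)) {S : Fin (n + 1) → Finset ((F : Type) →+* ℂ)}
    (hS : (U.hodgeClassesOf (U.cmProd F Θ) p).baseChange ℂ ⊓ U.weightSpace F Θ S (2 * p) ≠ ⊥) :
    (∑ j, ∑ s ∈ S j, ind (Θ j) s) = p ∧ (∑ j, ∑ s ∈ S j, (1 - ind (Θ j) s)) = p := by
  obtain ⟨x, hx, hx0⟩ := (Submodule.ne_bot_iff _).mp hS
  obtain ⟨hxB, hxS⟩ := Submodule.mem_inf.mp hx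
  have hn : (p : ℤ) + p = ((2 * p : ℕ) : ℤ) := by push_cast; ring
  have h1 : x ∈ (U.hodge (U.cmProd F Θ) (2 * p)).piece p p :=
    baseChange_hodgeClasses_le_piece (U.hodge (U.cmProd F Θ) (2 * p)) hn hxB
  have h2 := h30 F n Θ S hxS
  by_contra hne
  rw [← Prod.mk.injEq, ← Ne] at hne
  have hne' : ((∑ j, ∑ s ∈ S j, ind (Θ j) s), (∑ j, ∑ s ∈ S j, (1 - ind (Θ j) s))) ≠ ((p : ℤ), (p : ℤ)) :=
    fun h => hne (by rw [Prod.mk.injEq] at h ⊢; exact h)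
  have hbot := piece_inf_piece_eq_bot (U.hodge (U.cmProd F Θ) (2 * p)) hn hne'
  exact hx0 ((Submodule.mem_bot ℂ).mp (hbot ▸ Submodule.mem_inf.mpr ⟨h2, h1⟩))

end Weights

section Assembly

variable {F : CMField} [IsGalois ℚ F] {n : ℕ} {Θ : Fin (n + 1) → CMType F} {ι : Type} [Fintype ι]
  {j : ι → Fin (n + 1)} {a : ι → 𝓞 F} {c : ι → ℕ} {Mi : ι → U.Mor (U.cmProd F Θ) (U.cmProd F Θ)}

/-- Every weight met by the Hodge classes of level `p` is a Hodge weight — using M30 in degree `2p` only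
(cf. `isHodgeWeight_of_meets`). -/
theorem isHodgeWeight_of_meetsAt (M : U.ModelAxioms) (h29 : U.Fact_weightSpan) (p : ℕ)
    (h30 : U.Fact_weightHodgeAt (2 * p)) (hM : ∀ i, U.IsFactorAct F Θ (j i) (a i : F) (Mi i))
    (hinj : Function.Injective (sepVal j a c)) {S : Fin (n + 1) → Finset ((F : Type) →+* ℂ)}
    (hS : (U.hodgeClassesOf (U.cmProd F Θ) p).baseChange ℂ ⊓ U.weightSpace F Θ S (2 * p) ≠ ⊥) :
    IsHodgeWeight Θ p S := by
  refine ⟨?_, fun P => ?_⟩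
  · obtain ⟨hp, hq⟩ := types_of_meetsAt p h30 hS
    have hsum : (∑ j, ∑ s ∈ S j, ind (Θ j) s) + (∑ j, ∑ s ∈ S j, (1 - ind (Θ j) s)) =
        ((∑ j, (S j).card : ℕ) : ℤ) := by
      rw [← Finset.sum_add_distrib, Nat.cast_sum]
      refine Finset.sum_congr rfl fun j _ => ?_
      rw [← Finset.sum_add_distrib, Finset.sum_congr rfl fun s _ => add_sub_cancel (ind (Θ j) s) 1]
      simp
    rw [hp, hq] at hsum
    have : ((∑ j, (S j).card : ℕ) : ℤ) = ((2 * p : ℕ) : ℤ) := by rw [← hsum]; push_cast; ring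
    exact_mod_cast this
  · rw [← sum_sum_permWeight P.1 S fun j t => ind (Θ j) t]
    exact (types_of_meetsAt p h30 (meets_permWeight M h29 hM hinj p hS P)).1

end Assembly

/-- **Pohlmann's span inclusion at level `p` from M1–M28, M29 and M30 IN DEGREE `2p`** (the proof of `pohlmannSpan_holds`
with the localised hypothesis). -/
theorem pohlmannSpanAt_of_weightHodgeAt (M : U.ModelAxioms) (h29 : U.Fact_weightSpan) (p : ℕ)
    (h30 : U.Fact_weightHodgeAt (2 * p)) (F : CMField) [IsGalois ℚ F] (n : ℕ) (Θ : Fin (n + 1) → CMType F) :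
    (U.hodgeClassesOf (U.cmProd F Θ) p).map ofRat ≤
      (Submodule.span ℂ {x : U.CohC (U.cmProd F Θ) (2 * p) |
          ∃ S : Fin (n + 1) → Finset ((F : Type) →+* ℂ),
            IsHodgeWeight Θ p S ∧ U.IsWeightVector F Θ S (2 * p) x}).restrictScalars ℚ := by
  -- separating family and factor-wise multiplications
  obtain ⟨j, a, c, hinj⟩ := exists_separating_family (F := (F : Type)) n
  choose Mi hMi using fun i => exists_isFactorAct M F Θ (j i) (a i)
  have hinj' : Function.Injective (sepVal j a c) := hinj
  -- `B_ℂ ⊆ ⊕_{S ∈ T_B} V_S ⊆ span {weight vectors of Hodge weights}`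
  rw [Submodule.map_le_iff_le_comap]
  intro b hb
  rw [Submodule.mem_comap, Submodule.restrictScalars_mem]
  have hbC : ofRat b ∈ (U.hodgeClassesOf (U.cmProd F Θ) p).baseChange ℂ :=
    Submodule.tmul_mem_baseChange_of_mem 1 hb
  refine (baseChange_hodgeClassesOf_le M h29 hMi hinj' p).trans ?_ hbC
  refine iSup₂_le fun S hS => ?_
  intro x hx
  exact Submodule.subset_span ⟨S, isHodgeWeight_of_meetsAt M h29 p h30 hMi hinj' hS,
    (U.mem_weightSpace_iff F Θ S (2 * p) x).1 hx⟩

/-- **At level `0` the span inclusion needs N3 only**: the empty weight is a Hodge weight for `p = 0`, and under N3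
(`End` acts trivially on `H⁰`) every class of `H⁰(A′, ℂ)` is a weight vector of the empty weight. -/
theorem pohlmannSpanAt_zero_of_pull_H0 (hN3 : U.Fact_pull_H0) (F : CMField) (n : ℕ) (Θ : Fin (n + 1) → CMType F) :
    (U.hodgeClassesOf (U.cmProd F Θ) 0).map ofRat ≤
      (Submodule.span ℂ {x : U.CohC (U.cmProd F Θ) (2 * 0) |
          ∃ S : Fin (n + 1) → Finset ((F : Type) →+* ℂ),
            IsHodgeWeight Θ 0 S ∧ U.IsWeightVector F Θ S (2 * 0) x}).restrictScalars ℚ := by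
  rintro y -
  rw [Submodule.restrictScalars_mem]
  refine Submodule.subset_span ⟨fun _ => ∅, ⟨by simp, fun P => by simp⟩, fun j a Ma _ => ?_⟩
  rw [Finset.prod_empty, one_smul]
  have h : U.pull Ma (2 * 0) = LinearMap.id := hN3 _ Ma
  show (U.pull Ma (2 * 0)).baseChange ℂ y = y
  rw [h, LinearMap.baseChange_id]
  rfl

/-- **Pohlmann's span theorem from `ModelAxioms` + N1 + N2 + N3 — without N4 `Fact_hodge_F0`.**
Level `0`: `pohlmannSpanAt_zero_of_pull_H0`; level `p ≥ 1`: M29 = `weightSpan_of_facts M hN1 hN3`, M30 in degree `2p ≥ 2`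
= `weightHodgeAt_of_facts_of_pos M hN1 hN2`. -/
theorem pohlmannSpan_of_facts₃ (M : U.ModelAxioms) (hN1 : U.Fact_cupExterior) (hN2 : U.Fact_cup_hodge)
    (hN3 : U.Fact_pull_H0) : U.PohlmannSpan := by
  intro F hG _h6 n Θ p
  cases p with
  | zero => exact pohlmannSpanAt_zero_of_pull_H0 hN3 F n Θ
  | succ q =>
    exact pohlmannSpanAt_of_weightHodgeAt M (weightSpan_of_facts M hN1 hN3) (q + 1)
      (weightHodgeAt_of_facts_of_pos M hN1 hN2 (by omega)) F n Θ

/-- The package's `pohlmannSpan_of_facts` is the special case with the redundant hypothesis. -/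
theorem pohlmannSpan_of_facts_eq₃ (M : U.ModelAxioms) (hN1 : U.Fact_cupExterior) (hN2 : U.Fact_cup_hodge)
    (hN3 : U.Fact_pull_H0) (hN4 : U.Fact_hodge_F0) :
    U.pohlmannSpan_of_facts M hN1 hN2 hN3 hN4 = pohlmannSpan_of_facts₃ M hN1 hN2 hN3 := rfl


end Universe

end HodgeCM

end
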